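/-
Origin: expansion seat `planner-pub-hodgecm-pv03-g7-0`, handover #2 2026-08-18T12:56:27Z (`HOME/pub-hodgecm-pv03-g7/lean/Pv03g7/Gysin3.lean`, md5 729e2383, 439 lines);
landed by the gen-8 packager in gate run 30 as `HodgeCM/Model/ToyG2/Gysin3.lean` (import ^import Pv03g7\.GysinMap[ \t]*$→import HodgeCM.Model.ToyG2.GysinMap ×1).
-/
/-
pub-hodgecm cell (HodgeCMPerL) — DAG-node prover #03, generation 7 (`planner-pub-hodgecm-pv03-g7-0`, unit `pub-hodgecm-pv03-g7`).
WIP module `Pv03g7.Gysin3`; intended tree module `HodgeCM.Model.ToyG2.Gysin3` (kind L5: toy model / consistency witness).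
Its one WIP import `Pv03g7.GysinMap` ↦ `HodgeCM.Model.ToyG2.GysinMap`; all other imports are LANDED tree modules.
Nothing is cited; Lean + Mathlib axioms only.

# F7 `Fact_gysin` HOLDS in the generation-3 toy universe `toyUniverse₃`

`HodgeCM.Universe.Fact_gysin` (F7, `HodgeCM/StubTree/Qw8Geometric.lean`): for the block projections
`p_Y : P → Y = ∏_{j ≤ n} A_{Ξ j}`, `p_{Y'} : P → Y' = ∏_{i ≤ m} A_{Ξ (n+1+i)}` of a concatenated CM product
`P = ∏_k A_{Ξ k}` there is a Gysin map `gy_k : H^{k + 2 dim Y'}(P) → H^k(Y)` that (1) sends algebraic classes to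
algebraic classes one fibre-dimension lower and (2) satisfies the projection formula
`gy (p_Y^* e ∪ p_{Y'}^* ω) = tr_{Y'}(ω) · e`.

So far F7 was witnessed only VACUOUSLY (`HodgeCM.Toy.fact_gysin`: the exterior gen-1 model has `tr = 0`, so `gy = 0`
works; it FAILS in `curveFlat`, `HodgeCM.Toy.not_curveFlat_fact_gysin`); in the gen-2/3 universes, whose traces are the genuine top-degree forms
(`TraceSys`, T-CM holds: `fact3_trTopCM`), it was listed as the one binder of `Assembly.COR_CM_of_genericFacts` without
a model (`HodgeCM.Model.ToyG2.GenericFacts3`, toy-g3).  THIS FILE closes that gap: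

* `coord n X j : H¹(∏_i X_i) → H¹(X_j)` — the coordinate restrictions of the left-nested product `prodFin`, with
  `coord_comp_prj_self/_ne` (dual to the pull-backs `prj_j^*`), `sum_prj_comp_coord` (`Σ_j prj_j^* ∘ coord_j = id`)
  and `isHodge_coord`;
* `blockRes XP σ := Σ_j prj_j^* ∘ coord_{σ j} : H¹(∏_k X_k) → H¹(∏_j X_{σ j})` — the block restriction along an
  injective sub-family `σ` of factors: Hodge (`isHodge_blockRes`); `blockRes ∘ p^* = id` for any morphism `p` commuting
  with the projections of the block (`blockRes_comp_lin_self`, via `lin_eq_sum_of_comm`) and `blockRes ∘ q^* = 0` for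
  the projection `q` to a disjoint block (`blockRes_comp_lin_of_disjoint`); `IsBlockPair` supplies exactly these
  commutation identities in degree one (`lin_comp_eq_of_pull_one`);
* `gysin_core` — for ANY good objects and such `ψ`'s, the block contraction
  `gy_k := BlockGysin.contr k (2 dim Y') ψ₁ ψ₂ (tr_{Y'})` (`HodgeCM.Model.ToyG2.GysinMap`) satisfies (1) (Hodge level:
  `BlockGysin.theta_contr_mem_FF`, using `dim_ℂ F¹(Y') = dim Y'` for block-free `Y'`) and (2)
  (`BlockGysin.contr_wedge_map`);
* **`fact3_gysin T pl : (toyModel3With exteriorHodgeData T pl).Fact_gysin`** for EVERY trace system `T` and good block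
  assignment `pl`, in particular **`toyUniverse₃_fact_gysin d t : (toyUniverse₃ d t).Fact_gysin`** — no hypotheses.

With pv03-g6's `toyUniverse₃_modelAxioms_all` and toy-g3's `TrTopAll3` (`toyUniverse₃_genericFacts_but_gysin_all`: the
other ten binders) this makes ALL ELEVEN binders of `Assembly.COR_CM_of_genericFacts` (ModelAxioms, RealisationExistsFace,
N1 `Fact_cupExterior`, N2 `Fact_cup_hodge`, N3 `Fact_pull_H0`, N4 `Fact_hodge_F0`, F4 `Fact_cupAlg`, F5 `Fact_cupAssoc`,
F7 `Fact_gysin`, `Fact_dimProd`, T-CM `Fact_trTopCM`) hold in ONE universe `toyUniverse₃ 1 4` — corollary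
`HodgeCM.Model.ToyG2.GenericFactsAll3` (separate leaf, lands after `TrTopAll3`).
-/
import Mathlib
import Summits.HodgeConjecture.HodgeCM.Model.ToyG2.GysinMap
import Summits.HodgeConjecture.HodgeCM.Model.ToyG2.Universe3
import Summits.HodgeConjecture.HodgeCM.Model.ToyG2.TopWeight
import Summits.HodgeConjecture.HodgeCM.Model.ToyG2.Bidegree
import Summits.HodgeConjecture.HodgeCM.Model.Toy.ToyF2

noncomputable section

open scoped TensorProduct
open exteriorPower HodgeCM.Toy
open Literature.AlgebraicGeometry.Motives (CMType)
open Literature.AlgebraicGeometry.Motives.HodgeStructure (ofRat mem_hodgeClasses_iff)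

namespace HodgeCM.ToyG2

namespace BlockGysin

variable {D : HodgeData} {T : TraceSys} {pl : GBlocks}

local notation "U₃" => toyModel3With D T pl

/-! ### §1 Iterated products of good objects: block-freeness and coordinate restrictions -/

/-- (Ported verbatim from the HodgeCMPerL package; no docstring in the source.) -/
theorem isBlockFree_prodFin : ∀ (n : ℕ) (X : Fin (n + 1) → GObj), (∀ j, (X j).X.IsBlockFree) →
    ((U₃).prodFin n X).X.IsBlockFree := by
  intro n
  induction n with
  | zero => exact fun X h => h 0
  | succ n ih => exact fun X h => Obj₂.isBlockFree_prod (ih _ fun i => h i.castSucc) (h (Fin.last (n + 1)))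

/-- (Ported verbatim from the HodgeCMPerL package; no docstring in the source.) -/
theorem isBlockFree_cmProd (F : CMField) {n : ℕ} (Θ : Fin (n + 1) → CMType F) :
    ((U₃).cmProd F Θ).X.IsBlockFree :=
  isBlockFree_prodFin n _ fun j => isBlockFree_cmObj₂ F (Θ j)

/-- `(f ≫ g)^* = f^* ∘ g^*` on `H¹` (stated with the `simp`-normal head `Obj₂.Hom₂.comp`; the source is pinned) -/
theorem lin_comp₂ {P Q R : Obj₂} (f : Obj₂.Hom₂ P Q) (g : Obj₂.Hom₂ Q R) :
    (Obj₂.Hom₂.comp f g).lin = f.lin ∘ₗ g.lin := rfl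

/-- (Ported verbatim from the HodgeCMPerL package; no docstring in the source.) -/
theorem lin_comp₃ {P Q R : GObj} (f : (U₃).Mor P Q) (g : (U₃).Mor Q R) :
    ((U₃).comp f g).lin = f.lin ∘ₗ g.lin := rfl

/-- (Ported verbatim from the HodgeCMPerL package; no docstring in the source.) -/
theorem lin_id₂ (A : Obj₂) : (Obj₂.Hom₂.id A).lin = LinearMap.id := rfl

section Res

variable (D T pl)
variable (n : ℕ) (X : Fin (n + 1 + 1) → GObj)

/-- restriction `H¹(∏_{i ≤ n+1} X_i) → H¹(∏_{i ≤ n} X_i)` to the first `n + 1` factors (types pinned to `prodFin`) -/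
def fstRes : ((U₃).prodFin (n + 1) X).X.L →ₗ[ℚ] ((U₃).prodFin n (fun i => X i.castSucc)).X.L :=
  fstL ((U₃).prodFin n (fun i => X i.castSucc)).X.toObj (X (Fin.last (n + 1))).X.toObj

/-- restriction `H¹(∏_{i ≤ n+1} X_i) → H¹(X_{n+1})` to the last factor (types pinned to `prodFin`) -/
def sndRes : ((U₃).prodFin (n + 1) X).X.L →ₗ[ℚ] (X (Fin.last (n + 1))).X.L :=
  sndL ((U₃).prodFin n (fun i => X i.castSucc)).X.toObj (X (Fin.last (n + 1))).X.toObj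

variable {D T pl}

/-- (Ported verbatim from the HodgeCMPerL package; no docstring in the source.) -/
@[simp] theorem fstRes_fst (x : ((U₃).prodFin n (fun i => X i.castSucc)).X.L) :
    fstRes D T pl n X (Obj₂.Hom₂.lin (X := ((U₃).prodFin (n + 1) X).X)
      (Obj₂.Hom₂.fst ((U₃).prodFin n (fun i => X i.castSucc)).X (X (Fin.last (n + 1))).X) x) = x :=
  fstL_inlL _ _ x

/-- (Ported verbatim from the HodgeCMPerL package; no docstring in the source.) -/
@[simp] theorem fstRes_snd (y : (X (Fin.last (n + 1))).X.L) :
    fstRes D T pl n X (Obj₂.Hom₂.lin (X := ((U₃).prodFin (n + 1) X).X)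
      (Obj₂.Hom₂.snd ((U₃).prodFin n (fun i => X i.castSucc)).X (X (Fin.last (n + 1))).X) y) = 0 :=
  fstL_inrL _ _ y

/-- (Ported verbatim from the HodgeCMPerL package; no docstring in the source.) -/
@[simp] theorem sndRes_fst (x : ((U₃).prodFin n (fun i => X i.castSucc)).X.L) :
    sndRes D T pl n X (Obj₂.Hom₂.lin (X := ((U₃).prodFin (n + 1) X).X)
      (Obj₂.Hom₂.fst ((U₃).prodFin n (fun i => X i.castSucc)).X (X (Fin.last (n + 1))).X) x) = 0 :=
  sndL_inlL _ _ x

/-- (Ported verbatim from the HodgeCMPerL package; no docstring in the source.) -/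
@[simp] theorem sndRes_snd (y : (X (Fin.last (n + 1))).X.L) :
    sndRes D T pl n X (Obj₂.Hom₂.lin (X := ((U₃).prodFin (n + 1) X).X)
      (Obj₂.Hom₂.snd ((U₃).prodFin n (fun i => X i.castSucc)).X (X (Fin.last (n + 1))).X) y) = y :=
  sndL_inrL _ _ y

/-- `H¹(∏_{i ≤ n+1} X_i) = fst^* H¹(∏_{i ≤ n} X_i) ⊕ snd^* H¹(X_{n+1})` -/
theorem fst_fstRes_add_snd_sndRes (v : ((U₃).prodFin (n + 1) X).X.L) :
    Obj₂.Hom₂.lin (X := ((U₃).prodFin (n + 1) X).X)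
        (Obj₂.Hom₂.fst ((U₃).prodFin n (fun i => X i.castSucc)).X (X (Fin.last (n + 1))).X) (fstRes D T pl n X v)
      + Obj₂.Hom₂.lin (X := ((U₃).prodFin (n + 1) X).X)
        (Obj₂.Hom₂.snd ((U₃).prodFin n (fun i => X i.castSucc)).X (X (Fin.last (n + 1))).X) (sndRes D T pl n X v)
      = v :=
  inlL_fstL_add_inrL_sndL _ _ v

/-- (Ported verbatim from the HodgeCMPerL package; no docstring in the source.) -/
theorem isHodge_fstRes : Obj.IsHodge (X := ((U₃).prodFin n (fun i => X i.castSucc)).X.toObj)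
    (Y := ((U₃).prodFin (n + 1) X).X.toObj) (fstRes D T pl n X) :=
  isHodge_fstL _ _

/-- (Ported verbatim from the HodgeCMPerL package; no docstring in the source.) -/
theorem isHodge_sndRes : Obj.IsHodge (X := (X (Fin.last (n + 1))).X.toObj)
    (Y := ((U₃).prodFin (n + 1) X).X.toObj) (sndRes D T pl n X) :=
  isHodge_sndL _ _

end Res

variable (D T pl) in
/-- the coordinate restriction `H¹(∏_{i ≤ n} X_i) → H¹(X_j)` of the left-nested product `prodFin` -/
def coord : (n : ℕ) → (X : Fin (n + 1) → GObj) → (j : Fin (n + 1)) → (((U₃).prodFin n X).X.L →ₗ[ℚ] (X j).X.L)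
  | 0, X => Fin.lastCases (motive := fun j => (X 0).X.L →ₗ[ℚ] (X j).X.L) LinearMap.id (fun i => i.elim0)
  | n + 1, X => Fin.lastCases (motive := fun j => ((U₃).prodFin (n + 1) X).X.L →ₗ[ℚ] (X j).X.L)
      (sndRes D T pl n X) (fun i => coord n (fun i => X i.castSucc) i ∘ₗ fstRes D T pl n X)

/-- (Ported verbatim from the HodgeCMPerL package; no docstring in the source.) -/
theorem coord_zero (X : Fin (0 + 1) → GObj) : coord D T pl 0 X 0 = LinearMap.id := by
  show coord D T pl 0 X (Fin.last 0) = _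
  simp only [coord, Fin.lastCases_last]
  rfl

/-- (Ported verbatim from the HodgeCMPerL package; no docstring in the source.) -/
theorem coord_last (n : ℕ) (X : Fin (n + 1 + 1) → GObj) :
    coord D T pl (n + 1) X (Fin.last (n + 1)) = sndRes D T pl n X := by
  simp only [coord, Fin.lastCases_last]

/-- (Ported verbatim from the HodgeCMPerL package; no docstring in the source.) -/
theorem coord_castSucc (n : ℕ) (X : Fin (n + 1 + 1) → GObj) (i : Fin (n + 1)) :
    coord D T pl (n + 1) X i.castSucc = coord D T pl n (fun i => X i.castSucc) i ∘ₗ fstRes D T pl n X := by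
  simp only [coord, Fin.lastCases_castSucc]

/-- `coord_j ∘ prj_j^* = id` -/
theorem coord_prj_self : ∀ (n : ℕ) (X : Fin (n + 1) → GObj) (j : Fin (n + 1)) (y : (X j).X.L),
    coord D T pl n X j (((U₃).prj n X j).lin y) = y := by
  intro n
  induction n with
  | zero =>
    intro X j y
    obtain rfl : j = 0 := Subsingleton.elim (α := Fin 1) _ _
    rw [coord_zero, Universe.prj_zero]
    rfl
  | succ n ih =>
    intro X j
    induction j using Fin.lastCases with
    | last =>
      intro y
      rw [coord_last, Universe.prj_last]
      exact sndRes_snd n X y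
    | cast i =>
      intro y
      rw [coord_castSucc, Universe.prj_castSucc, lin_comp₃]
      simp only [LinearMap.coe_comp, Function.comp_apply, fstRes_fst]
      exact ih (fun i => X i.castSucc) i y

/-- `coord_j ∘ prj_l^* = 0` for `j ≠ l` -/
theorem coord_prj_ne : ∀ (n : ℕ) (X : Fin (n + 1) → GObj) (j l : Fin (n + 1)), j ≠ l →
    ∀ y : (X l).X.L, coord D T pl n X j (((U₃).prj n X l).lin y) = 0 := by
  intro n
  induction n with
  | zero => exact fun X j l h => absurd (Subsingleton.elim (α := Fin 1) j l) h
  | succ n ih =>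
    intro X j l hjl
    induction j using Fin.lastCases with
    | last =>
      induction l using Fin.lastCases with
      | last => exact absurd rfl hjl
      | cast i' =>
        intro y
        rw [coord_last, Universe.prj_castSucc, lin_comp₃]
        simp only [LinearMap.coe_comp, Function.comp_apply, sndRes_fst]
    | cast i =>
      induction l using Fin.lastCases with
      | last =>
        intro y
        rw [coord_castSucc, Universe.prj_last]
        simp only [LinearMap.coe_comp, Function.comp_apply, fstRes_snd, map_zero]
      | cast i' =>
        intro y
        have hii' : i ≠ i' := fun h => hjl (by rw [h])
        rw [coord_castSucc, Universe.prj_castSucc, lin_comp₃]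
        simp only [LinearMap.coe_comp, Function.comp_apply, fstRes_fst]
        exact ih (fun i => X i.castSucc) i i' hii' y

/-- (Ported verbatim from the HodgeCMPerL package; no docstring in the source.) -/
theorem coord_comp_prj_self (n : ℕ) (X : Fin (n + 1) → GObj) (j : Fin (n + 1)) :
    coord D T pl n X j ∘ₗ ((U₃).prj n X j).lin = LinearMap.id :=
  LinearMap.ext fun y => coord_prj_self n X j y

/-- (Ported verbatim from the HodgeCMPerL package; no docstring in the source.) -/
theorem coord_comp_prj_ne (n : ℕ) (X : Fin (n + 1) → GObj) (j l : Fin (n + 1)) (h : j ≠ l) :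
    coord D T pl n X j ∘ₗ ((U₃).prj n X l).lin = 0 :=
  LinearMap.ext fun y => coord_prj_ne n X j l h y

/-- `Σ_j prj_j^* ∘ coord_j = id`: `H¹(∏ X_i) = ⊕_j prj_j^* H¹(X_j)` -/
theorem sum_prj_coord : ∀ (n : ℕ) (X : Fin (n + 1) → GObj) (v : ((U₃).prodFin n X).X.L),
    ∑ j, ((U₃).prj n X j).lin (coord D T pl n X j v) = v := by
  intro n
  induction n with
  | zero =>
    intro X v
    rw [Fin.sum_univ_one, coord_zero, Universe.prj_zero]
    rfl
  | succ n ih =>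
    intro X v
    rw [Fin.sum_univ_castSucc, coord_last, Universe.prj_last]
    simp only [coord_castSucc, Universe.prj_castSucc, lin_comp₂, LinearMap.coe_comp, Function.comp_apply]
    rw [← map_sum, ih]
    exact fst_fstRes_add_snd_sndRes n X v

/-- (Ported verbatim from the HodgeCMPerL package; no docstring in the source.) -/
theorem sum_prj_comp_coord (n : ℕ) (X : Fin (n + 1) → GObj) :
    ∑ j, ((U₃).prj n X j).lin ∘ₗ coord D T pl n X j = LinearMap.id := by
  refine LinearMap.ext fun v => ?_
  simpa only [LinearMap.sum_apply, LinearMap.coe_comp, Function.comp_apply, LinearMap.id_coe, id_eq] using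
    sum_prj_coord n X v

/-- the coordinate restrictions are Hodge maps (`F¹ ↦ F¹`) -/
theorem isHodge_coord : ∀ (n : ℕ) (X : Fin (n + 1) → GObj) (j : Fin (n + 1)),
    Obj.IsHodge (X := (X j).X.toObj) (Y := ((U₃).prodFin n X).X.toObj) (coord D T pl n X j) := by
  intro n
  induction n with
  | zero =>
    intro X j
    obtain rfl : j = 0 := Subsingleton.elim (α := Fin 1) _ _
    rw [coord_zero]
    exact Obj.IsHodge.id
  | succ n ih =>
    intro X j
    induction j using Fin.lastCases with
    | last => rw [coord_last]; exact isHodge_sndRes n X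
    | cast i => rw [coord_castSucc]; exact (ih (fun i => X i.castSucc) i).comp (isHodge_fstRes n X)

/-! ### §2 Sums of linear / Hodge maps -/

/-- (Ported verbatim from the HodgeCMPerL package; no docstring in the source.) -/
theorem linComp_sum {ι M₁ M₂ M₃ : Type*} [AddCommGroup M₁] [Module ℚ M₁] [AddCommGroup M₂] [Module ℚ M₂]
    [AddCommGroup M₃] [Module ℚ M₃] (s : Finset ι) (g : M₂ →ₗ[ℚ] M₃) (f : ι → (M₁ →ₗ[ℚ] M₂)) :
    g ∘ₗ (∑ i ∈ s, f i) = ∑ i ∈ s, g ∘ₗ f i :=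
  LinearMap.ext fun x => by simp only [LinearMap.coe_comp, Function.comp_apply, LinearMap.sum_apply, map_sum]

/-- (Ported verbatim from the HodgeCMPerL package; no docstring in the source.) -/
theorem sum_linComp {ι M₁ M₂ M₃ : Type*} [AddCommGroup M₁] [Module ℚ M₁] [AddCommGroup M₂] [Module ℚ M₂]
    [AddCommGroup M₃] [Module ℚ M₃] (s : Finset ι) (f : ι → (M₂ →ₗ[ℚ] M₃)) (g : M₁ →ₗ[ℚ] M₂) :
    (∑ i ∈ s, f i) ∘ₗ g = ∑ i ∈ s, f i ∘ₗ g :=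
  LinearMap.ext fun x => by simp only [LinearMap.coe_comp, Function.comp_apply, LinearMap.sum_apply]

/-- (Ported verbatim from the HodgeCMPerL package; no docstring in the source.) -/
theorem isHodge_add {A B : Obj} {φ ψ : B.L →ₗ[ℚ] A.L} (hφ : Obj.IsHodge φ) (hψ : Obj.IsHodge ψ) :
    Obj.IsHodge (φ + ψ) := by
  rintro _ ⟨y, hy, rfl⟩
  rw [LinearMap.baseChange_add, LinearMap.add_apply]
  exact add_mem (hφ ⟨y, hy, rfl⟩) (hψ ⟨y, hy, rfl⟩)

/-- (Ported verbatim from the HodgeCMPerL package; no docstring in the source.) -/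
theorem isHodge_sum {A B : Obj} {ι : Type*} (s : Finset ι) (φ : ι → (B.L →ₗ[ℚ] A.L))
    (h : ∀ i ∈ s, Obj.IsHodge (φ i)) : Obj.IsHodge (∑ i ∈ s, φ i) :=
  Finset.sum_induction φ (fun f => Obj.IsHodge (X := A) (Y := B) f) (fun _ _ ha hb => isHodge_add ha hb)
    (isHodge_zero A B) h

/-! ### §3 The block restriction along an injective sub-family of factors -/

section Block

variable {N n : ℕ} (XP : Fin (N + 1) → GObj) (σ : Fin (n + 1) → Fin (N + 1))

/-- selecting one coordinate out of a sum of pull-backs along an injective sub-family of projections -/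
theorem coord_comp_sum_prj (hσ : Function.Injective σ) {V : Type*} [AddCommGroup V] [Module ℚ V]
    (g : (j : Fin (n + 1)) → (V →ₗ[ℚ] (XP (σ j)).X.L)) (j : Fin (n + 1)) :
    coord D T pl N XP (σ j) ∘ₗ (∑ l, ((U₃).prj N XP (σ l)).lin ∘ₗ g l) = g j := by
  rw [linComp_sum, Finset.sum_eq_single j]
  · rw [← LinearMap.comp_assoc, coord_comp_prj_self, LinearMap.id_comp]
  · intro l _ hl
    rw [← LinearMap.comp_assoc, coord_comp_prj_ne _ _ _ _ (hσ.ne hl.symm), LinearMap.zero_comp]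
  · exact fun h => absurd (Finset.mem_univ j) h

/-- a coordinate off the sub-family kills such a sum -/
theorem coord_comp_sum_prj_of_ne {V : Type*} [AddCommGroup V] [Module ℚ V]
    (g : (j : Fin (n + 1)) → (V →ₗ[ℚ] (XP (σ j)).X.L)) (k : Fin (N + 1)) (hk : ∀ l, k ≠ σ l) :
    coord D T pl N XP k ∘ₗ (∑ l, ((U₃).prj N XP (σ l)).lin ∘ₗ g l) = 0 := by
  rw [linComp_sum]
  refine Finset.sum_eq_zero fun l _ => ?_
  rw [← LinearMap.comp_assoc, coord_comp_prj_ne _ _ _ _ (hk l), LinearMap.zero_comp]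

variable (D T pl) in
/-- **the block restriction** `H¹(∏_k X_k) → H¹(∏_j X_{σ j})`: `Σ_j prj_j^* ∘ coord_{σ j}` -/
def blockRes : ((U₃).prodFin N XP).X.L →ₗ[ℚ] ((U₃).prodFin n (fun j => XP (σ j))).X.L :=
  ∑ j, ((U₃).prj n (fun j => XP (σ j)) j).lin ∘ₗ coord D T pl N XP (σ j)

/-- (Ported verbatim from the HodgeCMPerL package; no docstring in the source.) -/
theorem isHodge_blockRes : Obj.IsHodge (X := ((U₃).prodFin n (fun j => XP (σ j))).X.toObj)
    (Y := ((U₃).prodFin N XP).X.toObj) (blockRes D T pl XP σ) :=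
  isHodge_sum _ _ fun j _ => ((U₃).prj n (fun j => XP (σ j)) j).hom.hodge.comp (isHodge_coord N XP (σ j))

/-- lattice form of a degree-one pull-back identity -/
theorem lin_comp_eq_of_pull_one {P Y Z : GObj} (f : (U₃).Mor P Y) (g : (U₃).Mor Y Z) (h : (U₃).Mor P Z)
    (e : (U₃).pull (X := P) (Y := Y) f 1 ∘ₗ (U₃).pull (X := Y) (Y := Z) g 1 = (U₃).pull (X := P) (Y := Z) h 1) :
    f.lin ∘ₗ g.lin = h.lin := by
  apply lin_eq_of_map_one_eq
  rw [map_comp]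
  exact e

/-- a morphism `p : ∏_k X_k → ∏_j X_{σ j}` commuting with the projections pulls back as `Σ_j prj_{σ j}^* ∘ coord_j` -/
theorem lin_eq_sum_of_comm (p : (U₃).Mor ((U₃).prodFin N XP) ((U₃).prodFin n (fun j => XP (σ j))))
    (hp : ∀ j, p.lin ∘ₗ ((U₃).prj n (fun j => XP (σ j)) j).lin = ((U₃).prj N XP (σ j)).lin) :
    p.lin = ∑ j, ((U₃).prj N XP (σ j)).lin ∘ₗ coord D T pl n (fun j => XP (σ j)) j := by
  calc p.lin = p.lin ∘ₗ ∑ j, ((U₃).prj n (fun j => XP (σ j)) j).lin ∘ₗ coord D T pl n (fun j => XP (σ j)) j := by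
        rw [sum_prj_comp_coord, LinearMap.comp_id]
    _ = ∑ j, (p.lin ∘ₗ ((U₃).prj n (fun j => XP (σ j)) j).lin) ∘ₗ coord D T pl n (fun j => XP (σ j)) j := by
        rw [linComp_sum]
        simp only [LinearMap.comp_assoc]
    _ = _ := by simp only [hp]

/-- **`blockRes ∘ p^* = id`** for the block's own projection `p` -/
theorem blockRes_comp_lin_self (hσ : Function.Injective σ)
    (p : (U₃).Mor ((U₃).prodFin N XP) ((U₃).prodFin n (fun j => XP (σ j))))
    (hp : ∀ j, p.lin ∘ₗ ((U₃).prj n (fun j => XP (σ j)) j).lin = ((U₃).prj N XP (σ j)).lin) :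
    blockRes D T pl XP σ ∘ₗ p.lin = LinearMap.id := by
  rw [blockRes, sum_linComp]
  conv_rhs => rw [← sum_prj_comp_coord (D := D) (T := T) (pl := pl) n (fun j => XP (σ j))]
  refine Finset.sum_congr rfl fun j _ => ?_
  rw [LinearMap.comp_assoc, lin_eq_sum_of_comm XP σ p hp,
    coord_comp_sum_prj XP σ hσ (coord D T pl n (fun j => XP (σ j))) j]

/-- **`blockRes ∘ q^* = 0`** for the projection `q` to a disjoint block -/
theorem blockRes_comp_lin_of_disjoint {m : ℕ} (τ : Fin (m + 1) → Fin (N + 1)) (hστ : ∀ j i, σ j ≠ τ i)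
    (q : (U₃).Mor ((U₃).prodFin N XP) ((U₃).prodFin m (fun i => XP (τ i))))
    (hq : ∀ i, q.lin ∘ₗ ((U₃).prj m (fun i => XP (τ i)) i).lin = ((U₃).prj N XP (τ i)).lin) :
    blockRes D T pl XP σ ∘ₗ q.lin = 0 := by
  rw [blockRes, sum_linComp]
  refine Finset.sum_eq_zero fun j _ => ?_
  rw [LinearMap.comp_assoc, lin_eq_sum_of_comm XP τ q hq,
    coord_comp_sum_prj_of_ne XP τ (coord D T pl m (fun i => XP (τ i))) (σ j) (hστ j), LinearMap.comp_zero]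

end Block

/-! ### §4 The Gysin map of a block pair in the exterior gen-3 universe -/

section Exterior

variable (T pl)

local notation "UE" => toyModel3With exteriorHodgeData T pl


-- port_pkg: scope closed for this part
end Exterior
end BlockGysin
end HodgeCM.ToyG2
end
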